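import Literature.Topology.FourManifolds.MMSWRasmussenFacts
import Summits.SmoothPoincare4.SmoothPoincare4.Theses.DottedCircleRasmussen
import Summits.SmoothPoincare4.SmoothPoincare4.Theses.ZeroSurgeryExotic
import Summits.SmoothPoincare4.SmoothPoincare4.Theorems.DottedCircleRasmussenDcrGapStubObstructionShape
import Summits.SmoothPoincare4.SmoothPoincare4.Theorems.DottedCircleRasmussenDcrGapStubDepthZeroImport
import Summits.SmoothPoincare4.SmoothPoincare4.Theorems.DottedCircleRasmussenDcrGapStubSectorBlind
import Summits.SmoothPoincare4.SmoothPoincare4.Theorems.DottedCircleRasmussenDcrGapRungDecomposition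
import Summits.SmoothPoincare4.SmoothPoincare4.Theorems.DottedCircleRasmussenDcrGapReduction

/-!
# Crux `DottedCircleRasmussen.DcrGap` (stmt-SmoothPoincare4-16128) — line `Sketch`, skeleton v1.3

v1.3 (cycle 2, lead `prover-line-stmt-SmoothPoincare4-16128-c1-0`, 2026-08-16): the composition
`DcrGap_of` is now the LANDED sorry-free conditional reduction `helper_reduction`
(`Theorems/DottedCircleRasmussenDcrGapReduction.lean`: `(ZseHsliceNotSlice ∨ DcrRasmussenWitness) →
MMSW.sMinus_nonpos_of_isModelSliceDisc → DcrGap`) applied to the two stubs that remain open, and they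
are open for reasons OUTSIDE the line: `stub_mmsw819` is verbatim the Literature named fact
`MMSW.sMinus_nonpos_of_isModelSliceDisc` (MMSW Lemma 8.19; `MMSWRasmussenFactsProofs.lean` reduces it
to the stronger tower fact and documents that only the Khovanov–Lee TQFT of `#ʳ(S¹ × S²)` with
cobordism maps discharges it — Literature debt, XL), and `stub_supply` is verbatim
(item stmt-SmoothPoincare4-0520) ∨ (item stmt-SmoothPoincare4-16151), each of which exhibits an exotic
`S⁴` — the apex is crux-sized (handed back: `promote-stub`).  Position of the crux, all landed:
`SmoothPoincare4 → ¬ DcrGap` (`closes`), `¬ DcrGap → ¬ ZseHsliceNotSlice`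
(`Negative.not_fgmw_of_not_dcrGap`, p130570), `DcrGap ↔ ZseHsliceNotSlice ∨ (rung k ≥ 1)`
(`helper_rungDecomposition`, p130756), `supply → 8.19 → DcrGap` (`helper_reduction`).

v1.2 (cycle 1): lead `prover-line-stmt-SmoothPoincare4-16128-0` (gen 1, 2026-08-16). The line `Sketch` (crux-ideate r1 k2:
first lemmas of the cards `filling-disc-depth`, `dotted-trace-twins`, `w-slice-bennequin`) is reshaped
here into a skeleton that concludes the crux BY NAME along the composition the card `filling-disc-depth`
prescribes (= the route's two-layer plan): the ONE-HANDLE SLICE GAP follows from a SUPPLY served through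
two doors,

* **depth 0** — the `k = 0` import (`filling-disc-depth` §(1), "depth 0 = FGMW"): a knot that is slice in
  a homotopy 4-ball but not in `B⁴` (the waypoint `ZseHsliceNotSlice` of route `ZeroSurgeryExotic`, item
  stmt-SmoothPoincare4-0520), re-embedded on the ellipsoid `∂D_0`, IS a gap with no dotted circle
  (`stub_depthZeroImport`, provable now from the tree's Palais ball-complement theorem);
* **depth ≥ 1** — the engine: a Rasmussen certificate through the dotted circles
  (`DcrRasmussenWitness`, item stmt-SmoothPoincare4-16151) gives the gap through the OBSTRUCTION SHAPE
  theorem of card `w-slice-bennequin` (`stub_obstructionShape`: any obstruction `Obs r K` that vanishes on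
  knots bounding a model slice disc, for `K` and for its mirror `ρ ∘ K`, turns one obstructed
  complement-slice datum in a homotopy sphere into `DcrGap` — its transport hypothesis is the tree's
  PROVED standardisation `DcrGfgmw.exists_isModelSliceDisc_or_mirror_of_diffeomorph`), fed with
  `Obs r K := ∃ w : MMSWRasmussen r K, 0 < s₋ ∨ s₊ < 0`, whose vanishing on W-slice knots is MMSW
  Lemma 8.19 (`stub_mmsw819`, the named Literature fact `MMSW.sMinus_nonpos_of_isModelSliceDisc`:
  Khovanov–Lee homology in `#ʳ(S¹ × S²)`, NOT in the tree — the line's one piece of Literature debt).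

Stubs (registered with `ledger skeleton check`):

* `stub_depthZeroImport` — `ZseHsliceNotSlice → DcrGap` — LANDED p130420 (the lead's stub);
* `stub_obstructionShape` — the shape theorem above — LANDED p130336;
* `stub_mmsw819` — MMSW Lemma 8.19 in the model (Literature debt);
* `stub_supply` — THE APEX (open): `ZseHsliceNotSlice ∨ DcrRasmussenWitness` — a depth-0 witness or a
  Rasmussen certificate; either is an exotic `S⁴` (items 0520 / 16151, both open);
* `stub_sectorBlind` — SIDE STUB, LANDED p130670 (card `dotted-trace-twins`, first lemma A): `s₋` and `s₊`
  are invariant under the sphere twists `σ^j` (MMSW Thm. 2.8 for `σ`: `D(k⃗)(σ^j K) = D(k⃗ + j⃗)(K)`,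
  `MMSW.finiteApprox_sphereTwist_comp`), whence certificates are sector-blind
  (`certificate_allSectors`, derived below): the supply may be hunted over whole `σ`-orbits. It is
  consumed by the supply search, not by the composition.

Registered helpers (landed, `--supports`): `helper_reduction` (v1.3, file `…DcrGapReduction`: the
composition, conditional on the open stubs), `helper_rungZeroIff` (p130641, file `…DcrGapRungZero`: the
`k = 0` slice of the crux ↔ `ZseHsliceNotSlice` — NO surplus over FGMW at rung 0) and
`helper_rungDecomposition` (file `…DcrGapRungDecomposition`: `DcrGap ↔ ZseHsliceNotSlice ∨ ∃ k ≥ 1 datum`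
— the route's surplus is exactly its rungs `k ≥ 1`, where the engine lives). Referenced below.

`sorry` lives ONLY in `stub_*` (open: `stub_mmsw819` = Literature debt, `stub_supply` = the apex);
`DcrGap_of` concludes the crux BY NAME.
-/

noncomputable section

set_option linter.dupNamespace false

open scoped Manifold ContDiff Topology
open Function Set
open Literature.Topology.FourManifolds Literature.Topology.FourManifolds.MMSW

namespace Summit.SmoothPoincare4.SmoothPoincare4.Cruxes.DcrGap.Sketch

open Summit.SmoothPoincare4.SmoothPoincare4.Theses

/-! ## Registered stubs (v1) -/

/-- Stub 1 — LANDED p130420 (`Theorems.DcrGap.Sketch.stub_depthZeroImport`, file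
`Theorems/DottedCircleRasmussenDcrGapStubDepthZeroImport.lean`). Depth-0 door (card
`filling-disc-depth` §(1)): an `S³`-knot slice in a homotopy 4-ball but not in `B⁴` gives the
one-handle slice gap with `k = 0` — carry the knot to the ellipsoid `∂D_0 = {|z|²/40² + |w|² = 1}` by
the linear stretch `(z, w) ↦ (40z, w)`, the homotopy-ball disc along; a disc in `N ∖ e'(D_0)`,
`N ≅ S⁴`, would make the knot smoothly slice (Palais' ball-complement theorem).
[cite: FreedmanGompfMorrisonWalker2010, §1] [cite: Palais1960, Thm. B] -/
theorem stub_depthZeroImport : Summit.SmoothPoincare4.SmoothPoincare4.Theses.ZeroSurgeryExotic.ZseHsliceNotSlice → Summit.SmoothPoincare4.SmoothPoincare4.Theses.DottedCircleRasmussen.DcrGap :=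
  Summit.SmoothPoincare4.SmoothPoincare4.Theorems.DcrGap.Sketch.stub_depthZeroImport

/-- Stub 2 — LANDED p130336 (`Theorems.DcrGap.Sketch.stub_obstructionShape`, file
`Theorems/DottedCircleRasmussenDcrGapStubObstructionShape.lean`). Obstruction shape (card
`w-slice-bennequin`, `firstLemmaC_shape` with its transport hypothesis discharged by the tree): any
knot obstruction `Obs r K` that vanishes whenever `K`, resp. its mirror `ρ ∘ K`, bounds a model slice
disc in `ℝ⁴ ∖ D_r`, together with ONE model knot carrying `Obs` and a complement-slice datum in some
homotopy 4-sphere, gives `DcrGap` (standardisation in any `N ≅ S⁴`: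
`DcrGfgmw.exists_isModelSliceDisc_or_mirror_of_diffeomorph`, Palais). [cite: Palais1960, Thm. B] -/
theorem stub_obstructionShape : ∀ (Obs : (r : ℕ) → ((Metric.sphere (0 : EuclideanSpace ℝ (Fin 2)) 1) → EuclideanSpace ℝ (Fin 4)) → Prop), (∀ (r : ℕ) (K : (Metric.sphere (0 : EuclideanSpace ℝ (Fin 2)) 1) → EuclideanSpace ℝ (Fin 4)) (f : EuclideanSpace ℝ (Fin 2) → EuclideanSpace ℝ (Fin 4)), Literature.Topology.FourManifolds.MMSW.IsModelSliceDisc r K f → ¬ Obs r K) → (∀ (r : ℕ) (K : (Metric.sphere (0 : EuclideanSpace ℝ (Fin 2)) 1) → EuclideanSpace ℝ (Fin 4)) (f : EuclideanSpace ℝ (Fin 2) → EuclideanSpace ℝ (Fin 4)), Literature.Topology.FourManifolds.MMSW.IsModelSliceDisc r (Literature.Topology.FourManifolds.MMSW.modelMirror ∘ K) f → ¬ Obs r K) → (∃ (r : ℕ) (K : (Metric.sphere (0 : EuclideanSpace ℝ (Fin 2)) 1) → EuclideanSpace ℝ (Fin 4)), Literature.Topology.FourManifolds.MMSW.IsModelKnot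 r K ∧ Obs r K ∧ ∃ (M : Type) (_ : TopologicalSpace M) (_ : T2Space M) (_ : SecondCountableTopology M) (_ : ChartedSpace (EuclideanSpace ℝ (Fin 4)) M) (_ : IsManifold (𝓡 4) ((⊤ : ℕ∞) : WithTop ℕ∞) M), Nonempty (ContinuousMap.HomotopyEquiv M (Metric.sphere (0 : EuclideanSpace ℝ (Fin 5)) 1)) ∧ ∃ (e : EuclideanSpace ℝ (Fin 4) → M) (f : EuclideanSpace ℝ (Fin 2) → M), Literature.Topology.FourManifolds.MMSW.IsSliceDiscInComplement r K M e f) → Summit.SmoothPoincare4.SmoothPoincare4.Theses.DottedCircleRasmussen.DcrGap :=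
  Summit.SmoothPoincare4.SmoothPoincare4.Theorems.DcrGap.Sketch.stub_obstructionShape

/-- Stub 3 (Literature debt: MMSW Lemma 8.19 in the model — the body of the named fact
`MMSW.sMinus_nonpos_of_isModelSliceDisc`, stated unfolded; used as `@stub_mmsw819`). A null-homologous knot `K ⊂ ∂D_r` with `s₋(K) = s` bounding a
smooth proper disc in `ℝ⁴ ∖ D_r° ⊂ ♮ʳ(B² × S²)` has `s ≤ 0`. Rests on Khovanov–Lee homology in
`#ʳ(S¹ × S²)`, not in the tree. [cite: ManolescuMarengonSarkarWillis2023, Lemma 8.19] -/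
theorem stub_mmsw819 : ∀ {r : ℕ} {K : (Metric.sphere (0 : EuclideanSpace ℝ (Fin 2)) 1) → EuclideanSpace ℝ (Fin 4)} {s : ℤ} {f : EuclideanSpace ℝ (Fin 2) → EuclideanSpace ℝ (Fin 4)}, Literature.Topology.FourManifolds.MMSW.HasSMinus r K s → Literature.Topology.FourManifolds.MMSW.IsModelSliceDisc r K f → s ≤ 0 := by
  sorry

-- `stub_mmsw819` IS the Literature named fact `MMSW.sMinus_nonpos_of_isModelSliceDisc` (its body, word for
-- word); v1.3 registers and uses it in unfolded form (`@stub_mmsw819` where the fact is expected) so that no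
-- sorried theorem in the tree has the fact's NAME as its type — cf. the fact-registry anomaly reported by the
-- stmt-16153 seat (evidence `DcrGfgmw-c2-registry.md`).

/-- Stub 4 — THE APEX (open). The supply: EITHER a depth-0 witness (an `S³`-knot slice in a homotopy
4-ball, not in `B⁴`: item stmt-SmoothPoincare4-0520) OR a Rasmussen certificate through the dotted
circles (item stmt-SmoothPoincare4-16151: `k ≥ 1`, a null-homologous model knot sliced in some homotopy
sphere's `D_k`-complement with `s₋ > 0 ∨ s₊ < 0`). Either disproves SPC4.
[cite: FreedmanGompfMorrisonWalker2010, §1] [cite: ManolescuMarengonSarkarWillis2023, §9.3] -/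
theorem stub_supply : Summit.SmoothPoincare4.SmoothPoincare4.Theses.ZeroSurgeryExotic.ZseHsliceNotSlice ∨ Summit.SmoothPoincare4.SmoothPoincare4.Theses.DottedCircleRasmussen.DcrRasmussenWitness := by
  sorry

/-- Stub 5 — SIDE STUB, LANDED p130670 (`Theorems.DcrGap.Sketch.stub_sectorBlind`, file
`Theorems/DottedCircleRasmussenDcrGapStubSectorBlind.lean`; card `dotted-trace-twins`, first lemma A).
The MMSW invariants are blind to the sphere twists: for a loop `K` on `∂D_r` and every `j ∈ ℤ`,
`s₋(σ^j ∘ K) = s₋(K)` and `s₊(σ^j ∘ K) = s₊(K)` (as `HasSMinus`/`HasSPlus` statements). Mechanism: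
`D(k⃗)(σ^j K') = D(k⃗+j⃗)(K')` (`MMSW.finiteApprox_sphereTwist_comp`) shifts the eventual value;
isotopies and null-homologies are transported along the diffeomorphism `σ^j` of `∂D_r`; for `s₊`,
`ρ ∘ σ^j = σ^{-j} ∘ ρ` on `∂D_r`. [cite: ManolescuMarengonSarkarWillis2023, Thm. 2.8] -/
theorem stub_sectorBlind : ∀ (r : ℕ) (K : (Metric.sphere (0 : EuclideanSpace ℝ (Fin 2)) 1) → EuclideanSpace ℝ (Fin 4)) (j s : ℤ), (∀ t, K t ∈ Literature.Topology.FourManifolds.MMSW.modelBoundary r) → (Literature.Topology.FourManifolds.MMSW.HasSMinus r (Literature.Topology.FourManifolds.MMSW.sphereTwist r j ∘ K) s ↔ Literature.Topology.FourManifolds.MMSW.HasSMinus r K s) ∧ (Literature.Topology.FourManifolds.MMSW.HasSPlus r (Literature.Topology.FourManifolds.MMSW.sphereTwist r j ∘ K) s ↔ Literature.Topology.FourManifolds.MMSW.HasSPlus r K s) :=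
  Summit.SmoothPoincare4.SmoothPoincare4.Theorems.DcrGap.Sketch.stub_sectorBlind

/-! ## Derived (sorry-free given the stubs) -/

/-- The certificate obstruction of the route: `s₋(K) > 0 ∨ s₊(K) < 0` for some MMSW datum. -/
def Certificate (r : ℕ) (K : (Metric.sphere (0 : EuclideanSpace ℝ (Fin 2)) 1) → EuclideanSpace ℝ (Fin 4)) :
    Prop :=
  ∃ w : MMSWRasmussen r K, 0 < w.sMinus ∨ w.sPlus < 0

/-- **Lemma 8.19 kills certificates of W-slice knots** (`stub_mmsw819` + the model window
`MMSWRasmussen.sMinus_nonpos_sPlus_nonneg`). [cite: ManolescuMarengonSarkarWillis2023, Lemma 8.19] -/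
theorem not_certificate_of_isModelSliceDisc {r : ℕ}
    {K : (Metric.sphere (0 : EuclideanSpace ℝ (Fin 2)) 1) → EuclideanSpace ℝ (Fin 4)}
    {f : EuclideanSpace ℝ (Fin 2) → EuclideanSpace ℝ (Fin 4)} (hf : IsModelSliceDisc r K f) :
    ¬ Certificate r K := by
  rintro ⟨w, hw⟩
  have := w.sMinus_nonpos_sPlus_nonneg @stub_mmsw819 hf
  omega

/-- **… and of knots whose mirror is W-slice** (mirror rule `s_±(ρK) = -s_∓(K)`, MMSW Prop. 8.8 (1)).
[cite: ManolescuMarengonSarkarWillis2023, Lemma 8.19 and Prop. 8.8 (1)] -/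
theorem not_certificate_of_isModelSliceDisc_mirror {r : ℕ}
    {K : (Metric.sphere (0 : EuclideanSpace ℝ (Fin 2)) 1) → EuclideanSpace ℝ (Fin 4)}
    {f : EuclideanSpace ℝ (Fin 2) → EuclideanSpace ℝ (Fin 4)}
    (hf : IsModelSliceDisc r (modelMirror ∘ K) f) : ¬ Certificate r K := by
  rintro ⟨w, hw⟩
  have := w.modelMirror.sMinus_nonpos_sPlus_nonneg @stub_mmsw819 hf
  simp only [MMSWRasmussen.sMinus_modelMirror, MMSWRasmussen.sPlus_modelMirror] at this
  omega

/-- **The engine door**: a Rasmussen certificate through the dotted circles is a one-handle slice gap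
(shape theorem + Lemma 8.19). [cite: ManolescuMarengonSarkarWillis2023, Lemma 8.19 and §9.3] -/
theorem dcrGap_of_dcrRasmussenWitness (h : DottedCircleRasmussen.DcrRasmussenWitness) :
    DottedCircleRasmussen.DcrGap := by
  obtain ⟨k, -, K, hK, -, hM, w, hw⟩ := h
  exact stub_obstructionShape Certificate (fun r K f hf => not_certificate_of_isModelSliceDisc hf)
    (fun r K f hf => not_certificate_of_isModelSliceDisc_mirror hf) ⟨k, K, hK, ⟨w, hw⟩, hM⟩

/-- **Certificates are sector-blind** (from `stub_sectorBlind`): a certificate for `K ⊂ ∂D_r` is a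
certificate for every sphere twist `σ^j ∘ K`. [cite: ManolescuMarengonSarkarWillis2023, Thm. 2.8] -/
theorem certificate_allSectors {r : ℕ}
    {K : (Metric.sphere (0 : EuclideanSpace ℝ (Fin 2)) 1) → EuclideanSpace ℝ (Fin 4)}
    (h : Certificate r K) (j : ℤ) : Certificate r (sphereTwist r j ∘ K) := by
  obtain ⟨w, hw⟩ := h
  have hb : ∀ t, K t ∈ modelBoundary r := fun t => w.isModelKnot.mem t
  refine ⟨⟨w.sMinus, w.sPlus, ((stub_sectorBlind r K j w.sMinus hb).1).2 w.hasSMinus,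
    ((stub_sectorBlind r K j w.sPlus hb).2).2 w.hasSPlus⟩, hw⟩

/-- **Rung 0 of the crux is the FGMW waypoint** (landed helper `helper_rungZeroIff`, p130641): the `k = 0`
slice of `DcrGap` ↔ `ZseHsliceNotSlice`. [cite: FreedmanGompfMorrisonWalker2010, §1] -/
theorem rungZero_iff : (∃ K : (Metric.sphere (0 : EuclideanSpace ℝ (Fin 2)) 1) → EuclideanSpace ℝ (Fin 4), Literature.Topology.FourManifolds.MMSW.IsModelKnot 0 K ∧ (∃ (M : Type) (_ : TopologicalSpace M) (_ : T2Space M) (_ : SecondCountableTopology M) (_ : ChartedSpace (EuclideanSpace ℝ (Fin 4)) M) (_ : IsManifold (𝓡 4) ((⊤ : ℕ∞) : WithTop ℕ∞) M), Nonempty (ContinuousMap.HomotopyEquiv M (Metric.sphere (0 : EuclideanSpace ℝ (Fin 5)) 1)) ∧ ∃ (e : EuclideanSpace ℝ (Fin 4) → M) (f : EuclideanSpace ℝ (Fin 2) → M), Literature.Topology.FourManifolds.MMSW.IsSliceDiscInComplement 0 K M e f) ∧ ∀ (N : Type) [TopologicalSpace N] [T2Space N] [SecondCountableTopology N] [ChartedSpace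 (EuclideanSpace ℝ (Fin 4)) N] [IsManifold (𝓡 4) ((⊤ : ℕ∞) : WithTop ℕ∞) N], Nonempty (Diffeomorph (𝓡 4) (𝓡 4) N (Metric.sphere (0 : EuclideanSpace ℝ (Fin 5)) 1) ((⊤ : ℕ∞) : WithTop ℕ∞)) → ∀ (e' : EuclideanSpace ℝ (Fin 4) → N) (f' : EuclideanSpace ℝ (Fin 2) → N), ¬ Literature.Topology.FourManifolds.MMSW.IsSliceDiscInComplement 0 K N e' f') ↔ Summit.SmoothPoincare4.SmoothPoincare4.Theses.ZeroSurgeryExotic.ZseHsliceNotSlice :=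
  Summit.SmoothPoincare4.SmoothPoincare4.Theorems.DcrGap.Sketch.helper_rungZeroIff

/-- **The rung decomposition** (landed helper `helper_rungDecomposition`): `DcrGap` ↔ rung 0 (= FGMW
waypoint) ∨ a gap datum with `k ≥ 1` dotted circles. [cite: FreedmanGompfMorrisonWalker2010, §1] -/
theorem rungDecomposition : Summit.SmoothPoincare4.SmoothPoincare4.Theses.DottedCircleRasmussen.DcrGap ↔ (Summit.SmoothPoincare4.SmoothPoincare4.Theses.ZeroSurgeryExotic.ZseHsliceNotSlice ∨ ∃ k : ℕ, 1 ≤ k ∧ ∃ K : (Metric.sphere (0 : EuclideanSpace ℝ (Fin 2)) 1) → EuclideanSpace ℝ (Fin 4), Literature.Topology.FourManifolds.MMSW.IsModelKnot k K ∧ (∃ (M : Type) (_ : TopologicalSpace M) (_ : T2Space M) (_ : SecondCountableTopology M) (_ : ChartedSpace (EuclideanSpace ℝ (Fin 4)) M) (_ : IsManifold (𝓡 4) ((⊤ : ℕ∞) : WithTop ℕ∞) M), Nonempty (ContinuousMap.HomotopyEquiv M (Metric.sphere (0 : EuclideanSpace ℝ (Fin 5)) 1)) ∧ ∃ (e : EuclideanSpace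 ℝ (Fin 4) → M) (f : EuclideanSpace ℝ (Fin 2) → M), Literature.Topology.FourManifolds.MMSW.IsSliceDiscInComplement k K M e f) ∧ ∀ (N : Type) [TopologicalSpace N] [T2Space N] [SecondCountableTopology N] [ChartedSpace (EuclideanSpace ℝ (Fin 4)) N] [IsManifold (𝓡 4) ((⊤ : ℕ∞) : WithTop ℕ∞) N], Nonempty (Diffeomorph (𝓡 4) (𝓡 4) N (Metric.sphere (0 : EuclideanSpace ℝ (Fin 5)) 1) ((⊤ : ℕ∞) : WithTop ℕ∞)) → ∀ (e' : EuclideanSpace ℝ (Fin 4) → N) (f' : EuclideanSpace ℝ (Fin 2) → N), ¬ Literature.Topology.FourManifolds.MMSW.IsSliceDiscInComplement k K N e' f') :=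
  Summit.SmoothPoincare4.SmoothPoincare4.Theorems.DcrGap.Sketch.helper_rungDecomposition

/-- **The reduction** (landed helper `helper_reduction`, v1.3): the crux from its two open stubs —
`(ZseHsliceNotSlice ∨ DcrRasmussenWitness) → MMSW L8.19 → DcrGap` (depth-0 import `stub_depthZeroImport`;
engine door = the route's `DcrEngineGlue_proof` with `DcrGfgmw_of_mmsw819`).
[cite: FreedmanGompfMorrisonWalker2010, §1] [cite: ManolescuMarengonSarkarWillis2023, Lemma 8.19] -/
theorem reduction : (Summit.SmoothPoincare4.SmoothPoincare4.Theses.ZeroSurgeryExotic.ZseHsliceNotSlice ∨ Summit.SmoothPoincare4.SmoothPoincare4.Theses.DottedCircleRasmussen.DcrRasmussenWitness) → Literature.Topology.FourManifolds.MMSW.sMinus_nonpos_of_isModelSliceDisc → Summit.SmoothPoincare4.SmoothPoincare4.Theses.DottedCircleRasmussen.DcrGap :=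
  Summit.SmoothPoincare4.SmoothPoincare4.Theorems.DcrGap.Sketch.helper_reduction

/-! ## The composition (sorry-free; concludes the crux BY NAME) -/

/-- **`DcrGap` from the stubs**: case on the supply — a depth-0 witness goes through the `k = 0` import,
a Rasmussen certificate through the engine door. [cite: FreedmanGompfMorrisonWalker2010, §1]
[cite: ManolescuMarengonSarkarWillis2023, Lemma 8.19] -/
theorem DcrGap_of : Summit.SmoothPoincare4.SmoothPoincare4.Theses.DottedCircleRasmussen.DcrGap :=
  reduction stub_supply @stub_mmsw819

/-- The v1.2 composition, kept as a cross-check: the same case split done inside the skeleton (depth-0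
import / engine door via the obstruction-shape theorem). [cite: FreedmanGompfMorrisonWalker2010, §1]
[cite: ManolescuMarengonSarkarWillis2023, Lemma 8.19] -/
theorem DcrGap_of' : Summit.SmoothPoincare4.SmoothPoincare4.Theses.DottedCircleRasmussen.DcrGap :=
  stub_supply.elim stub_depthZeroImport dcrGap_of_dcrRasmussenWitness

end Summit.SmoothPoincare4.SmoothPoincare4.Cruxes.DcrGap.Sketch

end
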